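import Summits.PneNP.PneNP.Theorems.ExpanderLinearGeneratorsColumnTwoComponents
import Summits.PneNP.PneNP.Theorems.ExpanderLinearGeneratorsExpansionForcesDepthFregeSize

/-!
# PneNP / ExpanderLinearGenerators — column weight two: solvability of the linear system by closed
components

Route `PneNP/ExpanderLinearGenerators`, support for crux stmt-PneNP-11443. For a system
`E : Fin m → LinEqMod 2 n` in which every variable occurs in at most two rows, read through its row
scopes `i ↦ supp(E i)` (in `ℕ`):

* `coverDegree_le_two_of_col` — the scope family has column weight `≤ 2`;
* `sum_rows_eq_zero` — the rows of a boundaryless row set sum to zero;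
* `exists_assignment_off_designated` — peeling (`exists_rows_hold_of_forall_boundary_nonempty`)
  solves every row except the least row of each closed component;
* `holds_min_iff` — that row then holds iff the right-hand sides of its component sum to `0`;
* `exists_odd_closed_of_not_systemSat` — an unsolvable system has a closed component whose
  right-hand sides sum to `1`;
* `exists_assignment_of_even` — if every closed component has even right-hand side sum, the system
  is solvable (by a Boolean assignment, `B = 1` sum-encoding semantics).

[folklore: `𝔽₂`-linear algebra of graph incidence systems]
-/

namespace Summit.PneNP.PneNP.Theorems.ColumnTwo

open Finset Literature.Computability.MetaComplexity

variable {m n : ℕ}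

/-- Reading a support in `ℕ`. [folklore] -/
theorem mem_map_val_iff {s : Finset (Fin n)} {j : Fin n} :
    (j : ℕ) ∈ s.map Fin.valEmbedding ↔ j ∈ s :=
  Finset.mem_map' Fin.valEmbedding

/-- **Column weight two for the scopes.** [folklore] -/
theorem coverDegree_le_two_of_col (E : Fin m → LinEqMod 2 n)
    (hcol : ∀ j : Fin n, (Finset.univ.filter fun i => j ∈ (E i).supp).card ≤ 2) (v : ℕ) :
    coverDegree (fun i => (E i).supp.map Fin.valEmbedding) Finset.univ v ≤ 2 := by
  unfold coverDegree
  by_cases hv : v < n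
  · have : (Finset.univ.filter fun i => v ∈ (E i).supp.map Fin.valEmbedding) =
        Finset.univ.filter fun i => (⟨v, hv⟩ : Fin n) ∈ (E i).supp := by
      ext i
      simp only [Finset.mem_filter, Finset.mem_univ, true_and]
      exact Finset.mem_map' Fin.valEmbedding (a := (⟨v, hv⟩ : Fin n))
    rw [this]; exact hcol _
  · have : (Finset.univ.filter fun i => v ∈ (E i).supp.map Fin.valEmbedding) = ∅ := by
      refine Finset.eq_empty_of_forall_notMem fun i hi => hv ?_
      obtain ⟨j, -, rfl⟩ := Finset.mem_map.1 (Finset.mem_filter.1 hi).2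
      exact j.2
    rw [this]; simp

/-- The column sum of a row set at the variable `j`, in `𝔽₂`, is its cover degree. [folklore] -/
theorem sum_coeff_eq (E : Fin m → LinEqMod 2 n) (K : Finset (Fin m)) (j : Fin n) :
    ∑ i ∈ K, (E i).1 j =
      (coverDegree (fun i => (E i).supp.map Fin.valEmbedding) K (j : ℕ) : ZMod 2) := by
  unfold coverDegree
  have h1 : ∀ i, (E i).1 j = if j ∈ (E i).supp then 1 else 0 := by
    intro i
    by_cases h : j ∈ (E i).supp
    · rw [if_pos h]
      exact ((by decide : ∀ a : ZMod 2, a ≠ 0 → a = 1) _ (Finset.mem_filter.1 h).2)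
    · rw [if_neg h]
      by_contra h'
      exact h (Finset.mem_filter.2 ⟨Finset.mem_univ _, h'⟩)
  rw [Finset.sum_congr rfl fun i _ => h1 i, Finset.sum_ite, Finset.sum_const_zero, add_zero,
    Finset.sum_const, nsmul_eq_mul, mul_one]
  congr 2
  ext i
  simp only [Finset.mem_filter, mem_map_val_iff]

/-- **Rows of a boundaryless set sum to zero** (every variable is counted `0` or `2` times).
[folklore] -/
theorem sum_rows_eq_zero (E : Fin m → LinEqMod 2 n)
    (hcol : ∀ j : Fin n, (Finset.univ.filter fun i => j ∈ (E i).supp).card ≤ 2)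
    {K : Finset (Fin m)} (hK : boundary (fun i => (E i).supp.map Fin.valEmbedding) K = ∅)
    (z : Fin n → ZMod 2) : ∑ i ∈ K, ∑ j, (E i).1 j * z j = 0 := by
  rw [Finset.sum_comm]
  refine Finset.sum_eq_zero fun j _ => ?_
  rw [← Finset.sum_mul, sum_coeff_eq]
  set S : Fin m → Finset ℕ := fun i => (E i).supp.map Fin.valEmbedding
  have h2 : coverDegree S K (j : ℕ) ≤ 2 :=
    (coverDegree_mono (Finset.subset_univ K) _).trans (coverDegree_le_two_of_col E hcol _)
  have h1 : coverDegree S K (j : ℕ) ≠ 1 := fun h => by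
    have : (j : ℕ) ∈ boundary S K := mem_boundary_iff_coverDegree.2 h
    rw [hK] at this; exact Finset.notMem_empty _ this
  rcases Nat.lt_or_ge (coverDegree S K (j : ℕ)) 1 with h | h
  · rw [show coverDegree S K (j : ℕ) = 0 by omega]; simp
  · rw [show coverDegree S K (j : ℕ) = 2 by omega]
    exact mul_eq_zero_of_left (by decide) _

/-- **Peeling off the designated rows.** Some Boolean assignment satisfies every row that is not
the least row of a closed component. [cite: BenSassonWigderson2001, Lemma 5.7] -/
theorem exists_assignment_off_designated (E : Fin m → LinEqMod 2 n)
    (hcol : ∀ j : Fin n, (Finset.univ.filter fun i => j ∈ (E i).supp).card ≤ 2) :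
    ∃ σ : ℕ → Bool, ∀ i : Fin m,
      (¬ ∃ (K : Finset (Fin m)) (hK : K.Nonempty),
        IsConn (fun i => (E i).supp.map Fin.valEmbedding) K ∧
        boundary (fun i => (E i).supp.map Fin.valEmbedding) K = ∅ ∧ K.min' hK = i) →
      (E i).Holds (blockVals 2 1 n σ) := by
  classical
  set S : Fin m → Finset ℕ := fun i => (E i).supp.map Fin.valEmbedding with hS
  have hcw := coverDegree_le_two_of_col E hcol
  set I := Finset.univ.filter fun i : Fin m => ¬ ∃ (K : Finset (Fin m)) (hK : K.Nonempty),
    IsConn S K ∧ boundary S K = ∅ ∧ K.min' hK = i with hI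
  have hpeel : ∀ J ⊆ I, J.Nonempty → (boundary S J).Nonempty := by
    intro J hJI hJne
    by_contra hb
    rw [Finset.not_nonempty_iff_eq_empty] at hb
    obtain ⟨K, hKJ, hKne, hKc, hKb⟩ := exists_closed_subset hJne hb
    have hmin : K.min' hKne ∈ I := hJI (hKJ (Finset.min'_mem K hKne))
    exact (Finset.mem_filter.1 hmin).2 ⟨K, hKne, hKc, hKb, rfl⟩
  obtain ⟨σ, hσ⟩ := exists_rows_hold_of_forall_boundary_nonempty E I hpeel
  exact ⟨σ, fun i hi => hσ i (Finset.mem_filter.2 ⟨Finset.mem_univ _, hi⟩)⟩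

/-- **The designated row.** If all rows of a boundaryless set `K` other than `d ∈ K` hold under
`z`, then row `d` holds iff the right-hand sides of `K` sum to zero. [folklore] -/
theorem holds_iff_sum_eq_zero (E : Fin m → LinEqMod 2 n)
    (hcol : ∀ j : Fin n, (Finset.univ.filter fun i => j ∈ (E i).supp).card ≤ 2)
    {K : Finset (Fin m)} (hK : boundary (fun i => (E i).supp.map Fin.valEmbedding) K = ∅)
    {d : Fin m} (hd : d ∈ K) {z : Fin n → ZMod 2} (hz : ∀ i ∈ K.erase d, (E i).Holds z) :
    (E d).Holds z ↔ ∑ i ∈ K, (E i).2 = 0 := by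
  have hsum := sum_rows_eq_zero E hcol hK z
  rw [← Finset.add_sum_erase K _ hd] at hsum
  rw [← Finset.add_sum_erase K _ hd]
  have hrest : ∑ i ∈ K.erase d, ∑ j, (E i).1 j * z j = ∑ i ∈ K.erase d, (E i).2 :=
    Finset.sum_congr rfl fun i hi => hz i hi
  rw [hrest] at hsum
  unfold LinEqMod.Holds
  generalize ∑ j, (E d).1 j * z j = a at hsum ⊢
  generalize ∑ i ∈ K.erase d, (E i).2 = s at hsum ⊢
  generalize (E d).2 = b
  revert a s b; decide

/-- **An unsolvable system has an odd closed component.** [folklore] -/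
theorem exists_odd_closed_of_not_systemSat (E : Fin m → LinEqMod 2 n)
    (hcol : ∀ j : Fin n, (Finset.univ.filter fun i => j ∈ (E i).supp).card ≤ 2)
    (hunsat : ¬ SystemSat E Finset.univ) :
    ∃ K : Finset (Fin m), K.Nonempty ∧ IsConn (fun i => (E i).supp.map Fin.valEmbedding) K ∧
      boundary (fun i => (E i).supp.map Fin.valEmbedding) K = ∅ ∧ ∑ i ∈ K, (E i).2 = 1 := by
  classical
  have hcw := coverDegree_le_two_of_col E hcol
  obtain ⟨σ, hσ⟩ := exists_assignment_off_designated E hcol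
  by_contra hno
  push Not at hno
  refine hunsat ⟨blockVals 2 1 n σ, fun i _ => ?_⟩
  by_cases hdes : ∃ (K : Finset (Fin m)) (hK : K.Nonempty),
      IsConn (fun i => (E i).supp.map Fin.valEmbedding) K ∧
      boundary (fun i => (E i).supp.map Fin.valEmbedding) K = ∅ ∧ K.min' hK = i
  · obtain ⟨K, hKne, hKc, hKb, rfl⟩ := hdes
    rw [holds_iff_sum_eq_zero E hcol hKb (Finset.min'_mem K hKne)]
    · have h := hno K hKne hKc hKb
      generalize ∑ i ∈ K, (E i).2 = s at h ⊢
      revert s; decide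
    · intro i hi
      refine hσ i fun ⟨K', hK'ne, hK'c, hK'b, hK'i⟩ => ?_
      have hiK : i ∈ K := Finset.mem_of_mem_erase hi
      have hiK' : i ∈ K' := hK'i ▸ Finset.min'_mem K' hK'ne
      have heq : K' = K := closed_eq_of_inter_nonempty hcw hK'c hK'b hKc hKb ⟨i, Finset.mem_inter.2 ⟨hiK', hiK⟩⟩
      subst heq
      exact (Finset.mem_erase.1 hi).1 hK'i.symm
  · exact hσ i hdes

/-- **Solvability by parity of closed components.** If the right-hand sides of every closed
component sum to zero, some Boolean assignment satisfies all rows. [folklore] -/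
theorem exists_assignment_of_even (E : Fin m → LinEqMod 2 n)
    (hcol : ∀ j : Fin n, (Finset.univ.filter fun i => j ∈ (E i).supp).card ≤ 2)
    (heven : ∀ K : Finset (Fin m), K.Nonempty →
      IsConn (fun i => (E i).supp.map Fin.valEmbedding) K →
      boundary (fun i => (E i).supp.map Fin.valEmbedding) K = ∅ → ∑ i ∈ K, (E i).2 = 0) :
    ∃ σ : ℕ → Bool, ∀ i, (E i).Holds (blockVals 2 1 n σ) := by
  classical
  have hcw := coverDegree_le_two_of_col E hcol
  obtain ⟨σ, hσ⟩ := exists_assignment_off_designated E hcol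
  refine ⟨σ, fun i => ?_⟩
  by_cases hdes : ∃ (K : Finset (Fin m)) (hK : K.Nonempty),
      IsConn (fun i => (E i).supp.map Fin.valEmbedding) K ∧
      boundary (fun i => (E i).supp.map Fin.valEmbedding) K = ∅ ∧ K.min' hK = i
  · obtain ⟨K, hKne, hKc, hKb, rfl⟩ := hdes
    rw [holds_iff_sum_eq_zero E hcol hKb (Finset.min'_mem K hKne)]
    · exact heven K hKne hKc hKb
    · intro i hi
      refine hσ i fun ⟨K', hK'ne, hK'c, hK'b, hK'i⟩ => ?_
      have hiK : i ∈ K := Finset.mem_of_mem_erase hi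
      have hiK' : i ∈ K' := hK'i ▸ Finset.min'_mem K' hK'ne
      have heq : K' = K := closed_eq_of_inter_nonempty hcw hK'c hK'b hKc hKb ⟨i, Finset.mem_inter.2 ⟨hiK', hiK⟩⟩
      subst heq
      exact (Finset.mem_erase.1 hi).1 hK'i.symm
  · exact hσ i hdes

end Summit.PneNP.PneNP.Theorems.ColumnTwo

/-!
# PneNP / ExpanderLinearGenerators — column weight two: routing data inside one odd component

Route `PneNP/ExpanderLinearGenerators`, support for crux stmt-PneNP-11443. Fix a source system `E`
of column weight `≤ 2`, a TARGET system `E'` in which every variable lies in exactly two rows (a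
multigraph Tseitin system — the grid routing system in the application), and inside a connected
row set `K` of `E` a `K_{m'}` minor model `T : Fin m' → Finset (Fin m)` indexed by the target rows
(connected, pairwise disjoint, adjacent whenever the target rows share a variable). Then
(`exists_routing`) there are ROOTS `ρ a ∈ T a` (injective) and, for every target variable `x`
with target rows `a ≠ b`, a JOIN `J x` — a set of inner points of `T a ∪ T b` meeting a source row
`i` an odd number of times iff `i ∈ {ρ a, ρ b}` (`exists_tjoin`). Consequently a point of `J x`
only lies in source rows of `T a'` with `x ∈ supp (E' a')` (congestion `≤ |supp (E' a')|`).

[folklore; the routing step of Urquhart–Fu 1996 / Ben-Sasson 2002 in minor form]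
-/

namespace Summit.PneNP.PneNP.Theorems.ColumnTwo

open Finset Literature.Computability.MetaComplexity

variable {m n m' n' : ℕ}

/-- The two rows of a target variable. [folklore] -/
theorem exists_two_rows (E' : Fin m' → LinEqMod 2 n')
    (hcol2 : ∀ x : Fin n', (Finset.univ.filter fun a => x ∈ (E' a).supp).card = 2) (x : Fin n') :
    ∃ a b : Fin m', a ≠ b ∧ x ∈ (E' a).supp ∧ x ∈ (E' b).supp ∧
      ∀ c, x ∈ (E' c).supp → c = a ∨ c = b := by
  obtain ⟨a, b, hab, heq⟩ := Finset.card_eq_two.1 (hcol2 x)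
  have ha : a ∈ Finset.univ.filter fun c => x ∈ (E' c).supp := by rw [heq]; simp
  have hb : b ∈ Finset.univ.filter fun c => x ∈ (E' c).supp := by rw [heq]; simp
  refine ⟨a, b, hab, (Finset.mem_filter.1 ha).2, (Finset.mem_filter.1 hb).2, fun c hc => ?_⟩
  have : c ∈ Finset.univ.filter fun c => x ∈ (E' c).supp := Finset.mem_filter.2 ⟨Finset.mem_univ _, hc⟩
  rw [heq] at this
  simpa using this

/-- **Routing data in one component.** [folklore] -/
theorem exists_routing (E : Fin m → LinEqMod 2 n) (E' : Fin m' → LinEqMod 2 n')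
    (hcol : ∀ j : Fin n, (Finset.univ.filter fun i => j ∈ (E i).supp).card ≤ 2)
    (hcol2 : ∀ x : Fin n', (Finset.univ.filter fun a => x ∈ (E' a).supp).card = 2)
    {K : Finset (Fin m)} (T : Fin m' → Finset (Fin m))
    (hT1 : ∀ a, T a ⊆ K ∧ IsConn (fun i => (E i).supp.map Fin.valEmbedding) (T a) ∧ (T a).Nonempty)
    (hT2 : ∀ a b, a ≠ b → Disjoint (T a) (T b))
    (hT3 : ∀ a b, a ≠ b → ((E' a).supp ∩ (E' b).supp).Nonempty →
      ∃ i ∈ T a, ∃ j ∈ T b, ((E i).supp.map Fin.valEmbedding ∩ (E j).supp.map Fin.valEmbedding).Nonempty) :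
    ∃ (ρ : Fin m' → Fin m) (J : Fin n' → Finset ℕ),
      (∀ a, ρ a ∈ T a) ∧ Function.Injective ρ ∧
      (∀ x, J x ⊆ inner (fun i => (E i).supp.map Fin.valEmbedding) K) ∧
      (∀ x, ∀ v ∈ J x, ∀ i, v ∈ (E i).supp.map Fin.valEmbedding → ∃ a, i ∈ T a ∧ x ∈ (E' a).supp) ∧
      (∀ x i, Odd (((E i).supp.map Fin.valEmbedding ∩ J x).card) ↔
        ∃ a, ρ a = i ∧ x ∈ (E' a).supp) := by
  classical
  set S : Fin m → Finset ℕ := fun i => (E i).supp.map Fin.valEmbedding with hS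
  have hcw := coverDegree_le_two_of_col E hcol
  -- roots
  set ρ : Fin m' → Fin m := fun a => (T a).min' (hT1 a).2.2 with hρ
  have hρmem : ∀ a, ρ a ∈ T a := fun a => Finset.min'_mem _ _
  have hρinj : Function.Injective ρ := fun a b h => by
    by_contra hab
    exact Finset.disjoint_left.1 (hT2 a b hab) (hρmem a) (h ▸ hρmem b)
  -- joins, one target variable at a time
  have hjoin : ∀ x : Fin n', ∃ Jx : Finset ℕ, ∃ a b : Fin m', a ≠ b ∧ x ∈ (E' a).supp ∧
      x ∈ (E' b).supp ∧ (∀ c, x ∈ (E' c).supp → c = a ∨ c = b) ∧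
      Jx ⊆ inner S (T a ∪ T b) ∧ ∀ i, Even ((S i ∩ Jx).card) ↔ (i = ρ a ↔ i = ρ b) := by
    intro x
    obtain ⟨a, b, hab, hxa, hxb, honly⟩ := exists_two_rows E' hcol2 x
    have hconn : IsConn S (T a ∪ T b) := by
      refine (hT1 a).2.1.union (hT1 b).2.1 (Or.inl ?_)
      obtain ⟨i, hi, j, hj, hij⟩ := hT3 a b hab ⟨x, Finset.mem_inter.2 ⟨hxa, hxb⟩⟩
      exact ⟨i, hi, j, hj, hij⟩
    obtain ⟨Jx, hJx, hpar⟩ := exists_tjoin hcw hconn (Finset.mem_union_left _ (hρmem a))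
      (Finset.mem_union_right _ (hρmem b))
    exact ⟨Jx, a, b, hab, hxa, hxb, honly, hJx, hpar⟩
  choose J a b hab hxa hxb honly hJsub hJpar using hjoin
  refine ⟨ρ, J, hρmem, hρinj, fun x => ?_, fun x v hv i hvi => ?_, fun x i => ?_⟩
  · exact (hJsub x).trans (inner_mono (Finset.union_subset (hT1 _).1 (hT1 _).1))
  · -- a point of `J x` lies in two rows of `T a ∪ T b`; any row containing it is one of them
    have hin := hJsub x hv
    rw [mem_inner, coverDegree] at hin
    obtain ⟨i₁, hi₁, i₂, hi₂, hne⟩ := Finset.one_lt_card.1 hin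
    obtain ⟨hi₁T, hv₁⟩ := Finset.mem_filter.1 hi₁
    obtain ⟨hi₂T, hv₂⟩ := Finset.mem_filter.1 hi₂
    have hi : i ∈ T (a x) ∪ T (b x) := by
      rcases rows_eq_pair hcw hne hv₁ hv₂ hvi with rfl | rfl
      · exact hi₁T
      · exact hi₂T
    rcases Finset.mem_union.1 hi with h | h
    · exact ⟨a x, h, hxa x⟩
    · exact ⟨b x, h, hxb x⟩
  · rw [← Nat.not_even_iff_odd, hJpar x i]
    have hρab : ρ (a x) ≠ ρ (b x) := fun h => hab x (hρinj h)
    constructor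
    · intro h
      by_cases h1 : i = ρ (a x)
      · exact ⟨a x, h1.symm, hxa x⟩
      · have h2 : i = ρ (b x) := by tauto
        exact ⟨b x, h2.symm, hxb x⟩
    · rintro ⟨c, hc, hxc⟩
      rcases honly x c hxc with rfl | rfl
      · intro h; exact hρab (hc.trans (h.1 hc.symm))
      · intro h; exact hρab ((h.2 hc.symm).symm.trans hc.symm)

end Summit.PneNP.PneNP.Theorems.ColumnTwo
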